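import Literature.Probability.Percolation.KSTPeriodicStatements
import Literature.Probability.Percolation.KSTPeriodicSymmetry
import Literature.Probability.Percolation.RSW
import HarnessLib

/-!
# KST-type RSW for periodic measures: transferring arm and crossing bounds to the dual measure

Topic `Literature/Probability/Percolation`. Two consequences of the arm / dual-bridge duality
`ArmDuality` (`KSTPeriodicStatements.lean`, [KohlerSchindlerTassion2023, §1 Duality, footnote 3])
for a measure `μ` carried by lattice configurations and its planar dual `μ ∘ dualConfig⁻¹`
(faces indexed by lower-left corners, `Crossings.lean`):

* `one_sub_dual_bridge_le_arm`: `1 - μ*(𝓑̃_{t+1}(n; a)) ≤ μ(𝓐_t(n; a))` — the complement of the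
  arm event is contained in the dual bridge variant with margin `a` of the box `R_{t+1}(n + a, n)`
  ("`P[𝓑̃*(n)] = 1 - P[𝓐(n)]`", proof of Lemma 1(ii));
* `real_crossing_add_dual_lrRect_le_one`: `μ(𝓒_t(N, 8N)) + μ*(dual long crossing) ≤ 1` — a
  short-way crossing of `R_t(N, 8N)` excludes a dual left–right crossing of the faces of the
  transposed box ("`P[𝓒*(8n, n)] = 1 - P[𝓒(n, 8n)]`", one inequality of it).

The duality statement is about the dual of the configuration restricted to the edges of the box;
`dualConfig_mem_dualBridge_of_restrict` removes the restriction: a dual edge of the face region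
that is open only because the primal edge it crosses leaves the box joins two faces of the same
outer group, so the part of a dual bridge after its last visit to the left group is open in
`dualConfig ω` itself.

## References

* [KohlerSchindlerTassion2023] L. Köhler-Schindler, V. Tassion, *Crossing probabilities for
  planar percolation*, Duke Math. J. 172 (2023) 809–838, §1 (Duality), §3 (proof of Lemma 1).
* [GrimmettPercolation1999] G. Grimmett, *Percolation*, 2nd ed. (1999), §11.2.
-/

namespace Literature.Probability.Percolation

open _root_.MeasureTheory LatticeModels

noncomputable section

namespace KSTPeriodic

/-! ### Removing the restriction to the edges of the box -/

/-- If the dual of `ω ∩ E(R)` contains a dual bridge of the face region of `ArmDuality`, so does the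
dual of the lattice configuration `ω` itself. [cite: KohlerSchindlerTassion2023, §1 Duality] -/
theorem dualConfig_mem_dualBridge_of_restrict {x₁ x₂ y₁ y₂ u₁ u₂ : ℤ} (hxu : x₁ < u₁) (hu : u₁ < u₂)
    (hux : u₂ < x₂) (hy : y₁ < y₂) {ω : BondConfig (Site 2)} (hω : ω ⊆ (zdGraph 2).edgeSet)
    (h : dualConfig (ω ∩ {e | ∀ z ∈ e, x₁ ≤ z 0 ∧ z 0 ≤ x₂ ∧ y₁ ≤ z 1 ∧ z 1 ≤ y₂}) ∈
      openCrossing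
        ({f : Site 2 | x₁ ≤ f 0 ∧ f 0 ≤ x₂ - 1 ∧ y₁ ≤ f 1 ∧ f 1 ≤ y₂ - 1} ∪
          {f : Site 2 | (f 0 = x₁ - 1 ∧ y₁ - 1 ≤ f 1 ∧ f 1 ≤ y₂) ∨
            ((f 1 = y₂ ∨ f 1 = y₁ - 1) ∧ x₁ ≤ f 0 ∧ f 0 ≤ u₁ - 1)} ∪
          {f : Site 2 | (f 0 = x₂ ∧ y₁ - 1 ≤ f 1 ∧ f 1 ≤ y₂) ∨
            ((f 1 = y₂ ∨ f 1 = y₁ - 1) ∧ u₂ ≤ f 0 ∧ f 0 ≤ x₂ - 1)})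
        {f : Site 2 | (f 0 = x₁ - 1 ∧ y₁ - 1 ≤ f 1 ∧ f 1 ≤ y₂) ∨
          ((f 1 = y₂ ∨ f 1 = y₁ - 1) ∧ x₁ ≤ f 0 ∧ f 0 ≤ u₁ - 1)}
        {f : Site 2 | (f 0 = x₂ ∧ y₁ - 1 ≤ f 1 ∧ f 1 ≤ y₂) ∨
          ((f 1 = y₂ ∨ f 1 = y₁ - 1) ∧ u₂ ≤ f 0 ∧ f 0 ≤ x₂ - 1)}) :
    dualConfig ω ∈
      openCrossing
        ({f : Site 2 | x₁ ≤ f 0 ∧ f 0 ≤ x₂ - 1 ∧ y₁ ≤ f 1 ∧ f 1 ≤ y₂ - 1} ∪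
          {f : Site 2 | (f 0 = x₁ - 1 ∧ y₁ - 1 ≤ f 1 ∧ f 1 ≤ y₂) ∨
            ((f 1 = y₂ ∨ f 1 = y₁ - 1) ∧ x₁ ≤ f 0 ∧ f 0 ≤ u₁ - 1)} ∪
          {f : Site 2 | (f 0 = x₂ ∧ y₁ - 1 ≤ f 1 ∧ f 1 ≤ y₂) ∨
            ((f 1 = y₂ ∨ f 1 = y₁ - 1) ∧ u₂ ≤ f 0 ∧ f 0 ≤ x₂ - 1)})
        {f : Site 2 | (f 0 = x₁ - 1 ∧ y₁ - 1 ≤ f 1 ∧ f 1 ≤ y₂) ∨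
          ((f 1 = y₂ ∨ f 1 = y₁ - 1) ∧ x₁ ≤ f 0 ∧ f 0 ≤ u₁ - 1)}
        {f : Site 2 | (f 0 = x₂ ∧ y₁ - 1 ≤ f 1 ∧ f 1 ≤ y₂) ∨
          ((f 1 = y₂ ∨ f 1 = y₁ - 1) ∧ u₂ ≤ f 0 ∧ f 0 ≤ x₂ - 1)} := by
  set ER : Set (Sym2 (Site 2)) := {e | ∀ z ∈ e, x₁ ≤ z 0 ∧ z 0 ≤ x₂ ∧ y₁ ≤ z 1 ∧ z 1 ≤ y₂} with hER
  set Si : Set (Site 2) := {f : Site 2 | x₁ ≤ f 0 ∧ f 0 ≤ x₂ - 1 ∧ y₁ ≤ f 1 ∧ f 1 ≤ y₂ - 1} with hSi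
  set Lg : Set (Site 2) := {f : Site 2 | (f 0 = x₁ - 1 ∧ y₁ - 1 ≤ f 1 ∧ f 1 ≤ y₂) ∨
    ((f 1 = y₂ ∨ f 1 = y₁ - 1) ∧ x₁ ≤ f 0 ∧ f 0 ≤ u₁ - 1)} with hLg
  set Rg : Set (Site 2) := {f : Site 2 | (f 0 = x₂ ∧ y₁ - 1 ≤ f 1 ∧ f 1 ≤ y₂) ∨
    ((f 1 = y₂ ∨ f 1 = y₁ - 1) ∧ u₂ ≤ f 0 ∧ f 0 ≤ x₂ - 1)} with hRg
  set S : Set (Site 2) := Si ∪ Lg ∪ Rg with hS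
  -- an `S`-edge dual-open for `ω ∩ E(R)` but not for `ω` joins two faces of the same group
  have key : ∀ f g : Site 2, f ∈ S → g ∈ S → (zdGraph 2).Adj f g →
      s(f, g) ∈ dualConfig (ω ∩ ER) → s(f, g) ∉ dualConfig ω →
      (f ∈ Lg ∧ g ∈ Lg) ∨ (f ∈ Rg ∧ g ∈ Rg) := by
    intro f g hf hg hadj hin hnot
    rw [mem_dualConfig_iff, not_and] at hnot
    have hex : ∃ e' ∈ ω, dualEdge e' = s(f, g) := by
      have := hnot hadj
      push Not at this
      exact this
    obtain ⟨e', he'ω, he'eq⟩ := hex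
    have he'R : e' ∉ ER := fun hR => (mem_dualConfig_iff.1 hin).2 e' ⟨he'ω, hR⟩ he'eq
    obtain ⟨u, i, rfl⟩ := mem_edgeSet_zdGraph_iff.1 (hω he'ω)
    simp only [hER, Set.mem_setOf_eq, Sym2.mem_iff, forall_eq_or_imp, forall_eq, Pi.add_apply] at he'R
    simp only [hS, hSi, hLg, hRg, Set.mem_union, Set.mem_setOf_eq] at hf hg ⊢
    fin_cases i
    · simp only [Fin.zero_eta, Fin.isValue] at he'R he'eq
      rw [dualEdge_horizontal, Sym2.eq_iff] at he'eq
      simp only [single_zero_apply_zero, single_zero_apply_one, add_zero] at he'R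
      rcases he'eq with ⟨rfl, rfl⟩ | ⟨rfl, rfl⟩
      · simp only [Pi.sub_apply, single_one_apply_zero, single_one_apply_one, sub_zero] at hf hg ⊢
        omega
      · simp only [Pi.sub_apply, single_one_apply_zero, single_one_apply_one, sub_zero] at hf hg ⊢
        omega
    · simp only [Fin.mk_one, Fin.isValue] at he'R he'eq
      rw [dualEdge_vertical, Sym2.eq_iff] at he'eq
      simp only [single_one_apply_zero, single_one_apply_one, add_zero] at he'R
      rcases he'eq with ⟨rfl, rfl⟩ | ⟨rfl, rfl⟩
      · simp only [Pi.sub_apply, single_zero_apply_zero, single_zero_apply_one, sub_zero] at hf hg ⊢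
        omega
      · simp only [Pi.sub_apply, single_zero_apply_zero, single_zero_apply_one, sub_zero] at hf hg ⊢
        omega
  -- induction along a walk ending in the right group
  have main : ∀ (f r : Site 2) (W : (zdGraph 2).Walk f r), r ∈ Rg → (∀ z ∈ W.support, z ∈ S) →
      (∀ e ∈ W.edges, e ∈ dualConfig (ω ∩ ER)) →
      (∃ r' ∈ Rg, dualConfig ω ∈ openConnIn S f r') ∨
        (∃ l' ∈ Lg, ∃ r' ∈ Rg, dualConfig ω ∈ openConnIn S l' r') := by
    intro f r W
    induction W with
    | nil => exact fun hr hS' _ => Or.inl ⟨_, hr, openConnIn_refl (hS' _ (by simp))⟩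
    | cons hadj W' ih =>
      intro hr hS' hE
      rename_i f g r
      have hfS : f ∈ S := hS' f (by simp)
      have hgS : g ∈ S := hS' g (by simp)
      have hfg : s(f, g) ∈ dualConfig (ω ∩ ER) := hE _ (by simp)
      rcases ih hr (fun z hz => hS' z (by simp [hz])) (fun e he => hE e (by simp [he])) with
        ⟨r', hr', hconn⟩ | hdone
      · by_cases hin : s(f, g) ∈ dualConfig ω
        · exact Or.inl ⟨r', hr',
            PlanarDuality.openConnIn_trans (openConnIn_of_adj hfS hgS hin hadj.ne) hconn⟩
        · rcases key f g hfS hgS hadj hfg hin with ⟨-, hgL⟩ | ⟨hfR, -⟩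
          · exact Or.inr ⟨g, hgL, r', hr', hconn⟩
          · exact Or.inl ⟨f, hfR, openConnIn_refl hfS⟩
      · exact Or.inr hdone
  obtain ⟨l, hl, rr, hrr, hlr⟩ := h
  obtain ⟨W, hWS, hWω⟩ :=
    exists_walk_of_mem_openConnIn (fun _ h => h.1 : dualConfig (ω ∩ ER) ⊆ (zdGraph 2).edgeSet) hlr
  rcases main l rr W hrr hWS hWω with ⟨r', hr', hconn⟩ | ⟨l', hl', r', hr', hconn⟩
  · exact ⟨l, hl, r', hr', hconn⟩
  · exact ⟨l', hl', r', hr', hconn⟩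

/-! ### The arm event and the dual bridge variant -/

/-- Probabilities of events under the image measure `μ ∘ dualConfig⁻¹`. [folklore] -/
theorem real_map_dualConfig (μ : Measure (BondConfig (Site 2))) {A : Set (BondConfig (Site 2))}
    (hA : MeasurableSet A) : (μ.map dualConfig).real A = μ.real (dualConfig ⁻¹' A) := by
  rw [measureReal_def, Measure.map_apply measurable_dualConfig hA, measureReal_def]

/-- **`1 - P*[𝓑̃*(n)] ≤ P[𝓐(n)]`** ([KohlerSchindlerTassion2023], proof of Lemma 1(ii)): for a
measure carried by lattice configurations, outside the arm event `arm t a n` the dual configuration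
contains a bridge with margin `a` of the face box `R_{t+1}(n + a, n)`, so
`1 - (μ ∘ dualConfig⁻¹)(bridge (t + 1) a n) ≤ μ(arm t a n)`.
[cite: KohlerSchindlerTassion2023, §3, proof of Lemma 1(ii)] -/
theorem one_sub_dual_bridge_le_arm (hDu : ArmDuality) {μ : Measure (BondConfig (Site 2))}
    [IsProbabilityMeasure μ] (hL : LatticeCarried μ) {t a n : ℕ} (hn : 1 ≤ n) (ha : 1 ≤ a) :
    1 - (μ.map dualConfig).real (bridge (t + 1) a n) ≤ μ.real (arm t a n) := by
  rw [real_map_dualConfig μ (measurableSet_bridge _ _ _)]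
  have hc : μ.real (arm t a n)ᶜ ≤ μ.real (dualConfig ⁻¹' bridge (t + 1) a n) := by
    refine ENNReal.toReal_mono (measure_ne_top _ _) (measure_mono_ae ?_)
    filter_upwards [hL] with ω hω hnot
    have hx := hDu (-((n : ℤ) + a) - t) (n + a) (-(n : ℤ) - t) n (-(a : ℤ) - t) a (by omega)
      (by omega) (by omega) (by omega) ω hω
    rcases hx with ⟨harm, -⟩ | ⟨hdual, -⟩
    · exact absurd harm hnot
    · have h2 := dualConfig_mem_dualBridge_of_restrict (by omega) (by omega) (by omega) (by omega)
        hω hdual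
      refine openCrossing_mono ?_ ?_ ?_ h2
      · rintro f ((hf | hf) | hf) <;>
          simp only [Set.mem_setOf_eq, mem_rect] at hf ⊢ <;> push_cast <;> omega
      · intro f hf
        simp only [Set.mem_setOf_eq, leftPart, mem_rect] at hf ⊢
        push_cast
        omega
      · intro f hf
        simp only [Set.mem_setOf_eq, rightPart, mem_rect] at hf ⊢
        push_cast
        omega
  rw [probReal_compl_eq_one_sub (measurableSet_arm _ _ _)] at hc
  linarith

/-! ### Short primal crossings and long dual crossings -/

/-- **`P[𝓒_t(N, 8N)] + P*[long dual crossing] ≤ 1`** ([KohlerSchindlerTassion2023], proof of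
Lemma 1(ii): "`P[𝓒*(8n, n)] = 1 - P[𝓒(n, 8n)]`", the inequality used): a short-way crossing of
`R_t(N, 8N)` is, after transposition, a top–bottom crossing of `[-8N - t, 8N] × [-N - t, N]`,
which by `ArmDuality` (for the box widened by one column on each side) excludes a dual left–right
crossing of the face box `[-8N - t - 2, 8N + 1] × [-N - t, N - 1]`.
[cite: KohlerSchindlerTassion2023, §3, proof of Lemma 1(ii)] -/
theorem real_crossing_add_dual_lrRect_le_one (hDu : ArmDuality) {k t : ℕ}
    {μ : Measure (BondConfig (Site 2))} [IsProbabilityMeasure μ] (hμ : Admissible k t μ)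
    (hL : LatticeCarried μ) {N : ℕ} (hN : 1 ≤ N) :
    μ.real (crossing t N (8 * N)) +
      (μ.map dualConfig).real
        (lrRect (-((8 * N : ℕ) : ℤ) - t - 2) ((8 * N : ℕ) + 1) (-(N : ℤ) - t) (N - 1)) ≤ 1 := by
  rw [real_map_dualConfig μ (measurableSet_lrRect _ _ _ _)]
  -- the primal event of `ArmDuality` for the widened transposed box
  set A : Set (BondConfig (Site 2)) :=
    openCrossing {x : Site 2 | -((8 * N : ℕ) : ℤ) - t - 1 ≤ x 0 ∧ x 0 ≤ (8 * N : ℕ) + 1 ∧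
        -(N : ℤ) - t ≤ x 1 ∧ x 1 ≤ N}
      {x : Site 2 | -((8 * N : ℕ) : ℤ) - t ≤ x 0 ∧ x 0 ≤ (8 * N : ℕ) ∧ x 1 = N}
      {x : Site 2 | -((8 * N : ℕ) : ℤ) - t ≤ x 0 ∧ x 0 ≤ (8 * N : ℕ) ∧ x 1 = -(N : ℤ) - t} with hA
  set D : Set (BondConfig (Site 2)) :=
    dualConfig ⁻¹' lrRect (-((8 * N : ℕ) : ℤ) - t - 2) ((8 * N : ℕ) + 1) (-(N : ℤ) - t) (N - 1) with hD
  have hDm : MeasurableSet D := measurable_dualConfig (measurableSet_lrRect _ _ _ _)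
  have h1 : μ.real (crossing t N (8 * N)) ≤ μ.real A := by
    have he : μ.real (crossing t N (8 * N)) =
        μ.real (tbRect (-((8 * N : ℕ) : ℤ) - t) (8 * N : ℕ) (-(N : ℤ) - t) N) := by
      rw [real_tbRect_eq_real_lrRect hμ]; rfl
    rw [he, tbRect, openCrossing_comm]
    refine measureReal_mono (openCrossing_mono ?_ ?_ ?_)
    · intro x hx; simp only [mem_rect, Set.mem_setOf_eq] at hx ⊢; omega
    · intro x hx; simp only [mem_rect, Set.mem_setOf_eq] at hx ⊢; omega
    · intro x hx; simp only [mem_rect, Set.mem_setOf_eq] at hx ⊢; omega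
  have hinter : μ.real (A ∩ D) = 0 := by
    rw [measureReal_def, measure_eq_zero_iff_ae_notMem.2, ENNReal.toReal_zero]
    filter_upwards [hL] with ω hω hmem
    obtain ⟨hAω, hDω⟩ := hmem
    have hx := hDu (-((8 * N : ℕ) : ℤ) - t - 1) ((8 * N : ℕ) + 1) (-(N : ℤ) - t) N
      (-((8 * N : ℕ) : ℤ) - t) (8 * N : ℕ) (by omega) (by omega) (by omega) (by omega) ω hω
    rcases hx with ⟨-, hnd⟩ | ⟨-, hnA⟩
    · refine hnd (isUpperSet_openCrossing _ _ _ (dualConfig_antitone Set.inter_subset_left) ?_)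
      refine openCrossing_mono ?_ ?_ ?_ hDω
      · intro f hf
        simp only [mem_rect, Set.mem_union, Set.mem_setOf_eq] at hf ⊢
        omega
      · intro f hf
        simp only [mem_rect, Set.mem_setOf_eq] at hf ⊢
        omega
      · intro f hf
        simp only [mem_rect, Set.mem_setOf_eq] at hf ⊢
        omega
    · exact hnA hAω
  have hunion := measureReal_union_add_inter (μ := μ) (s := A) hDm
  rw [hinter, add_zero] at hunion
  have hle : μ.real (A ∪ D) ≤ 1 := measureReal_le_one
  linarith

end KSTPeriodic

end

end Literature.Probability.Percolation
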